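import Summits.SmoothPoincare4.SmoothPoincare4.Theorems.ConvexBisectionAcyclicBisectionExistsDualHandlePush
import HarnessLib

/-!
# Dual handles, XIII: the model push read in Kosinski's tube — smooth ACROSS the attaching circle
(brick (PUSH-e) of the sub-goal T3b step (ii) "push the prefix sub-handlebody `X₁` off the cocore
neighbourhood `N` of the suffix handles" of stub `stub_steinRealisation` (NF6), line
`modp-braid-orbits` r11, crux `ConvexBisection.AcyclicBisectionExists`, item
stmt-SmoothPoincare4-10508; wave 3, lead c5, worker Z3)

The global push is `sh : X₁ → X₁`, the identity off the tube `h̄ⱼ(T)` of the `j`-th attaching circle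
`γ`, and `h̄ⱼ ∘ α ∘ modelPush κ δ ∘ α ∘ h̄ⱼ⁻¹` on `h̄ⱼ(T ∖ γ)` (`α = handleInversion 2`, Kosinski's
involution; `T ∖ γ ↔ {0 < ‖y_λ‖ < 1}`, `α(T ∖ γ)` = `{x_λ ≠ 0, ‖x‖ ≤ 1}` = the handle chart of
`X₁ ∖ γ`).  Whether `sh` extends smoothly over `γ = {‖y_λ‖ = 1}` (where `α` degenerates: it blows
`γ` up into the cocore disc) is decided by the composite `modelPush ∘ α` in the tube coordinate `y`.
This file computes it (`modelPush_handleInversion`): for `0 < ‖y_λ‖² = s < 1` with `1 - s ≤ κ²/2`,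

    modelPush κ δ (α y) = tubePush κ δ y := ( √(pushP κ (1 - s) (‖y_μ‖²/κ²)/s) · y_λ , (√δ/κ) · y_μ ),

an expression which is smooth on the open set `tubePushDom κ = {y_λ ≠ 0, pushP κ (1-s) (‖y_μ‖²/κ²) > 0}`
CONTAINING `γ` (`contDiffOn_tubePush`, `circle_subset_tubePushDom`), and sends `γ` onto the circle
`C = {x_μ = 0, ‖x_λ‖² = pFun κ 0 = κ²/8}` (`tubePush_of_mem_circle`) — the circle missing from the
image `pushTarget` of the punctured handle (`…DualHandlePushImage.lean`).  Hence the globalised push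
and `jX₁' = Ξ ∘ modelPush ∘ α` near `γ` are smooth, for the next brick (T3b (ii) `jX₁'`).
(The `μ`-scaling `Φ₁` of the push is exactly what absorbs the blow-up factor `√(s/(1-s))` of `α`.)
Everything here is proved; no named facts.

## References
* J. Milnor, *Lectures on the h-cobordism theorem* (1965), §3 (dual handles). [MilnorHCobordism1965]
* A. A. Kosinski, *Differential Manifolds* (1993), VI §6, (6.1). [Kosinski1993]
-/

noncomputable section

-- the prescribed namespace `Summit.<P>.<Sub>.…` duplicates `SmoothPoincare4` (P = Sub)
set_option linter.dupNamespace false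

open scoped Manifold ContDiff Topology

namespace Summit.SmoothPoincare4.SmoothPoincare4.Theorems.AcyclicBisectionExists.ModpBraidOrbits

open Set Function Metric
open Literature.Topology.FourManifolds Literature.Topology.FourManifolds.HandleAttachingMap

namespace PushModel

section Tube

variable {κ δ : ℝ}

/-- **The push in tube coordinates** `( √(pushP κ (1-s) (‖y_μ‖²/κ²)/s) y_λ , (√δ/κ) y_μ )`,
`s = ‖y_λ‖²`. [folklore] -/
def tubePush (κ δ : ℝ) (y : EuclideanSpace ℝ (Fin 4)) : EuclideanSpace ℝ (Fin 4) :=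
  torusScale (Real.sqrt (pushP κ (1 - sOf y) (muN y / κ ^ 2) / sOf y)) (Real.sqrt δ / κ) y

/-- Its domain of smoothness `{y_λ ≠ 0, pushP κ (1 - s) (‖y_μ‖²/κ²) > 0}`. [folklore] -/
def tubePushDom (κ : ℝ) : Set (EuclideanSpace ℝ (Fin 4)) :=
  {y | lamPart y ≠ 0 ∧ 0 < pushP κ (1 - sOf y) (muN y / κ ^ 2)}

/-- The domain is open. [folklore] -/
theorem isOpen_tubePushDom (hκ : 0 < κ) : IsOpen (tubePushDom κ) := by
  have h1 : IsOpen {y : EuclideanSpace ℝ (Fin 4) | lamPart y ≠ 0} := isOpen_ne.preimage contDiff_lamPart.continuous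
  have h2 : Continuous fun y : EuclideanSpace ℝ (Fin 4) => pushP κ (1 - sOf y) (muN y / κ ^ 2) :=
    (contDiff_pushP hκ).continuous.comp
      ((continuous_const.sub contDiff_sOf.continuous).prodMk (contDiff_muN.continuous.div_const _))
  exact h1.inter (isOpen_lt continuous_const h2)

/-- **The attaching circle `γ = {‖y_λ‖ = 1, y_μ = 0}` lies in the domain** (there the pushed level is
`pushP κ 0 0 = pFun κ 0 = κ²/8 > 0`). [folklore] -/
theorem circle_subset_tubePushDom (hκ : 0 < κ) :
    {y : EuclideanSpace ℝ (Fin 4) | ‖lamPart y‖ = 1 ∧ muPart y = 0} ⊆ tubePushDom κ := by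
  rintro y ⟨h1, h2⟩
  refine ⟨fun h => by rw [h, norm_zero] at h1; exact zero_ne_one h1, ?_⟩
  have hs : sOf y = 1 := by rw [sOf, h1, one_pow]
  have hm : muN y = 0 := by rw [muN, h2, norm_zero]; ring
  have hb := pushP_base hκ 0
  rw [mul_zero] at hb
  rw [hs, hm, sub_self, zero_div, hb]
  exact pFun_pos hκ le_rfl

/-- **The punctured closed ball `{‖y‖ ≤ 1, y_λ ≠ 0}` (the tube part of `X₁ ∖ γ`) lies in the domain.**
[folklore] -/
theorem puncturedBall_subset_tubePushDom (hκ : 0 < κ) :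
    {y : EuclideanSpace ℝ (Fin 4) | ‖y‖ ≤ 1 ∧ lamPart y ≠ 0} ⊆ tubePushDom κ := by
  rintro y ⟨h1, h2⟩
  refine ⟨h2, ?_⟩
  have hsum : sOf y + muN y ≤ 1 := by
    rw [sOf, muN, ← norm_sq_eq_lamPart_muPart]; nlinarith [norm_nonneg y]
  have hQ : 0 ≤ muN y := sq_nonneg _
  rcases lt_or_ge (sOf y) 1 with hs | hs
  · exact lt_of_lt_of_le (by linarith) (le_pushP hκ _ _)
  · have hs1 : sOf y = 1 := by linarith
    have hm : muN y = 0 := by linarith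
    have hb := pushP_base hκ 0
    rw [mul_zero] at hb
    rw [hs1, hm, sub_self, zero_div, hb]
    exact pFun_pos hκ le_rfl

/-- **`tubePush κ δ` is smooth on `tubePushDom κ` — in particular across `γ`.** [folklore] -/
theorem contDiffOn_tubePush (hκ : 0 < κ) (δ : ℝ) : ContDiffOn ℝ ∞ (tubePush κ δ) (tubePushDom κ) := by
  have hP' : ContDiff ℝ ∞ fun y : EuclideanSpace ℝ (Fin 4) => pushP κ (1 - sOf y) (muN y / κ ^ 2) :=
    (contDiff_pushP hκ).comp ((contDiff_const.sub contDiff_sOf).prodMk (contDiff_muN.div_const _))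
  refine contDiffOn_torusScale (ContDiffOn.sqrt ?_ fun y hy => ?_) contDiffOn_const
  · exact hP'.contDiffOn.div contDiff_sOf.contDiffOn fun y hy => (sOf_pos_iff.2 hy.1).ne'
  · exact (div_pos hy.2 (sOf_pos_iff.2 hy.1)).ne'

/-- **`γ` goes onto the circle `C`**: for `‖y_λ‖ = 1`, `y_μ = 0`,
`tubePush κ δ y = √(pFun κ 0) · (y_λ, 0)`, so `‖(tubePush y)_λ‖² = pFun κ 0`, `(tubePush y)_μ = 0`.
[folklore] -/
theorem tubePush_of_mem_circle (hκ : 0 < κ) {y : EuclideanSpace ℝ (Fin 4)} (h1 : ‖lamPart y‖ = 1)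
    (h2 : muPart y = 0) : tubePush κ δ y = Real.sqrt (pFun κ 0) • lamEmbed (lamPart y) := by
  have hs : sOf y = 1 := by rw [sOf, h1, one_pow]
  have hm : muN y = 0 := by rw [muN, h2, norm_zero]; ring
  have hb := pushP_base hκ 0
  rw [mul_zero] at hb
  rw [tubePush, torusScale, hs, hm, sub_self, zero_div, hb, div_one, h2, muEmbed_zero, smul_zero, add_zero]

/-- The image of `γ` is the circle `C = {x_μ = 0, ‖x_λ‖² = pFun κ 0}`. [folklore] -/
theorem tubePush_circle (hκ : 0 < κ) {y : EuclideanSpace ℝ (Fin 4)} (h1 : ‖lamPart y‖ = 1)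
    (h2 : muPart y = 0) : ‖lamPart (tubePush κ δ y)‖ ^ 2 = pFun κ 0 ∧ muPart (tubePush κ δ y) = 0 := by
  rw [tubePush_of_mem_circle hκ h1 h2, lamPart_smul, muPart_smul, lamPart_lamEmbed, muPart_lamEmbed, smul_zero,
    norm_sqrt_smul_sq (pFun_pos hκ le_rfl).le, h1, one_pow, mul_one]
  exact ⟨rfl, rfl⟩

/-- `α y` as a torus scaling of `y`: `α y = ((√(1-s)/√s) y_λ, (√s/√(1-s)) y_μ)`. [cite: Kosinski1993, VI (6.1)] -/
theorem handleInversion_eq_torusScale (y : EuclideanSpace ℝ (Fin 4)) :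
    handleInversion 2 y =
      torusScale (Real.sqrt (1 - sOf y) / Real.sqrt (sOf y)) (Real.sqrt (sOf y) / Real.sqrt (1 - sOf y)) y := by
  conv_lhs => rw [← lamEmbed_add_muEmbed (handleInversion 2 y)]
  rw [lamPart_handleInversion, muPart_handleInversion, ← sOf_eq_lamSq, lamEmbed_smul, muEmbed_smul, torusScale]

/-- `P (α y) = 1 - s` (`0 < s ≤ 1`). [cite: Kosinski1993, VI (6.1)] -/
theorem sOf_handleInversion {y : EuclideanSpace ℝ (Fin 4)} (h0 : 0 < sOf y) (h1 : sOf y ≤ 1) :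
    sOf (handleInversion 2 y) = 1 - sOf y := by
  rw [sOf_eq_lamSq, sOf_eq_lamSq] at *
  exact lamSq_handleInversion h0 h1

/-- `Q (α y) = (s/(1-s)) ‖y_μ‖²` (`0 ≤ s < 1`). [cite: Kosinski1993, VI (6.1)] -/
theorem muN_handleInversion {y : EuclideanSpace ℝ (Fin 4)} (h0 : 0 ≤ sOf y) (h1 : sOf y < 1) :
    muN (handleInversion 2 y) = sOf y / (1 - sOf y) * muN y := by
  rw [muN, handleInversion_eq_torusScale, muPart_torusScale, norm_smul, mul_pow, Real.norm_of_nonneg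
    (div_nonneg (Real.sqrt_nonneg _) (Real.sqrt_nonneg _)), div_pow, Real.sq_sqrt h0,
    Real.sq_sqrt (by linarith), muN]

/-- **THE PUSH IN THE TUBE**: for `0 < s = ‖y_λ‖² < 1` with `1 - s ≤ κ²/2`,
`modelPush κ δ (α y) = tubePush κ δ y`.  (The `μ`-scaling of the push, `√(δP/(κ²(1-P)))` at
`P = 1 - s`, cancels the blow-up factor `√(s/(1-s))` of `α` exactly; the push argument
`g(P) Q(α y)/δ` is `‖y_μ‖²/κ²`.) [folklore] -/
theorem modelPush_handleInversion (hκ : 0 < κ) (hκ2 : κ ≤ 1 / 2) (hδ : 0 < δ) {y : EuclideanSpace ℝ (Fin 4)}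
    (h0 : 0 < sOf y) (h1 : sOf y < 1) (hκs : 1 - sOf y ≤ κ ^ 2 / 2) :
    modelPush κ δ (handleInversion 2 y) = tubePush κ δ y := by
  set s := sOf y with hsd
  have h1s : 0 < 1 - s := by linarith
  have hsx : sOf (handleInversion 2 y) = 1 - s := sOf_handleInversion h0 h1.le
  have hmx : muN (handleInversion 2 y) = s / (1 - s) * muN y := muN_handleInversion h0.le h1
  have hg : muScaleSq κ δ (1 - s) = δ * (1 - s) / (κ ^ 2 * s) := by
    rw [muScaleSq_of_le hκ hκ2 hκs, sub_sub_cancel]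
  have hq : muScaleSq κ δ (1 - s) * (s / (1 - s) * muN y) / δ = muN y / κ ^ 2 := by
    rw [hg]; field_simp
  have hA : 0 ≤ Real.sqrt s := Real.sqrt_nonneg _
  have hB : 0 < Real.sqrt (1 - s) := Real.sqrt_pos.2 h1s
  have hS : 0 < Real.sqrt s := Real.sqrt_pos.2 h0
  set P' := pushP κ (1 - s) (muN y / κ ^ 2) with hP'd
  have hP' : 0 < P' := lt_of_lt_of_le h1s (le_pushP hκ _ _)
  rw [modelPush, hsx, hmx, hq, tubePush, ← hsd]
  conv_lhs => rw [handleInversion_eq_torusScale, ← hsd, torusScale_torusScale]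
  congr 1
  · rw [Real.sqrt_div' _ h1s.le, Real.sqrt_div' _ h0.le, div_mul_div_comm, mul_comm (Real.sqrt (1 - s)),
      mul_div_mul_right _ _ hB.ne']
  · rw [hg, show δ * (1 - s) / (κ ^ 2 * s) = (δ / κ ^ 2) * ((1 - s) / s) by field_simp, Real.sqrt_mul
      (by positivity), Real.sqrt_div' _ (sq_nonneg κ), Real.sqrt_sq hκ.le, Real.sqrt_div' _ h0.le,
      mul_assoc, div_mul_div_comm, mul_comm (Real.sqrt (1 - s)), div_self (mul_pos hS hB).ne', mul_one]

/-! Two more facts on `α` in the coordinate `s = sOf`, and the pushed level of `α y`. -/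

/-- `α` is smooth on `{0 < s < 1}`. [cite: Kosinski1993, VI (6.1)] -/
theorem contDiffOn_handleInversion_sOf :
    ContDiffOn ℝ ∞ (handleInversion (m := 4) 2) {y | 0 < sOf y ∧ sOf y < 1} := by
  have h : ∀ y : EuclideanSpace ℝ (Fin 4), handleInversion 2 y =
      torusScale (Real.sqrt (1 - sOf y) / Real.sqrt (sOf y)) (Real.sqrt (sOf y) / Real.sqrt (1 - sOf y)) y :=
    handleInversion_eq_torusScale
  have h1 : ContDiffOn ℝ ∞ (fun y => Real.sqrt (sOf y)) {y | 0 < sOf y ∧ sOf y < 1} :=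
    contDiff_sOf.contDiffOn.sqrt fun y hy => hy.1.ne'
  have h2 : ContDiffOn ℝ ∞ (fun y => Real.sqrt (1 - sOf y)) {y | 0 < sOf y ∧ sOf y < 1} :=
    (contDiffOn_const.sub contDiff_sOf.contDiffOn).sqrt fun y hy => by have := hy.2; exact ne_of_gt (by linarith)
  refine (contDiffOn_torusScale (h2.div h1 fun y hy => (Real.sqrt_pos.2 hy.1).ne')
    (h1.div h2 fun y hy => (Real.sqrt_pos.2 (by have := hy.2; linarith)).ne')).congr fun y _ => h y

/-- `α ∘ α = id` on `{0 < s < 1}`. [cite: Kosinski1993, VI §6] -/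
theorem handleInversion_handleInversion_sOf {y : EuclideanSpace ℝ (Fin 4)} (h0 : 0 < sOf y) (h1 : sOf y < 1) :
    handleInversion 2 (handleInversion 2 y) = y :=
  handleInversion_handleInversion (by rwa [← sOf_eq_lamSq]) (by rwa [← sOf_eq_lamSq])

/-- The pushed level of `α y` lies in `(0, 1)` and is `< κ²/2` as soon as `1 - s < κ²/2`. [folklore] -/
theorem sOf_modelPush_handleInversion (hκ : 0 < κ) (hκ2 : κ ≤ 1 / 2) {y : EuclideanSpace ℝ (Fin 4)}
    (h0 : 0 < sOf y) (h1 : sOf y < 1) :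
    0 < sOf (modelPush κ δ (handleInversion 2 y)) ∧ sOf (modelPush κ δ (handleInversion 2 y)) < 1 ∧
      (1 - sOf y < κ ^ 2 / 2 → sOf (modelPush κ δ (handleInversion 2 y)) < κ ^ 2 / 2) := by
  have hP : sOf (handleInversion 2 y) = 1 - sOf y := sOf_handleInversion h0 h1.le
  have hx : lamPart (handleInversion 2 y) ≠ 0 := sOf_pos_iff.1 (by rw [hP]; linarith)
  have hκsq : κ ^ 2 ≤ 1 / 4 := by nlinarith
  rw [sOf_modelPush hκ hx, hP]
  set q := muScaleSq κ δ (1 - sOf y) * muN (handleInversion 2 y) / δ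
  refine ⟨lt_of_lt_of_le (by linarith) (le_pushP hκ _ _), ?_, fun h => (pushP_mem hκ h).2⟩
  rcases lt_or_ge (1 - sOf y) (κ ^ 2 / 2) with h | h
  · linarith [(pushP_mem hκ h (q := q)).2]
  · rw [pushP_of_ge q h]; linarith

end Tube

end PushModel

/-- **Registered helper `helper_modelPush_handleInversion` (brick (PUSH-e) of T3b (ii), sub-goal of NF6
`stub_steinRealisation`, wave 3, lead c5): read through Kosinski's inversion `α`, the model push of
`X₁` off the cocore neighbourhood is, near the attaching circle `γ = {‖y_λ‖ = 1, y_μ = 0}`, the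
restriction of the explicit map `tubePush κ δ`, smooth on an open set containing `γ`, which sends `γ`
onto the circle `{x_μ = 0, ‖x_λ‖² = pFun κ 0}`** — so the tube-supported global push and
`Ξ ∘ modelPush ∘ α` extend smoothly across `γ`. [folklore] -/
theorem helper_modelPush_handleInversion : ∀ {κ δ : ℝ}, 0 < κ → κ ≤ 1 / 2 → 0 < δ → IsOpen (Summit.SmoothPoincare4.SmoothPoincare4.Theorems.AcyclicBisectionExists.ModpBraidOrbits.PushModel.tubePushDom κ) ∧ {y : EuclideanSpace ℝ (Fin 4) | ‖Literature.Topology.FourManifolds.lamPart y‖ = 1 ∧ Literature.Topology.FourManifolds.muPart y = 0} ⊆ Summit.SmoothPoincare4.SmoothPoincare4.Theorems.AcyclicBisectionExists.ModpBraidOrbits.PushModel.tubePushDom κ ∧ ContDiffOn ℝ ∞ (Summit.SmoothPoincare4.SmoothPoincare4.Theorems.AcyclicBisectionExists.ModpBraidOrbits.PushModel.tubePush κ δ) (Summit.SmoothPoincare4.SmoothPoincare4.Theorems.AcyclicBisectionExists.ModpBraidOrbits.PushModel.tubePushDom κ) ∧ (∀ y : EuclideanSpace ℝ (Fin 4), 0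 < ‖Literature.Topology.FourManifolds.lamPart y‖ ^ 2 → ‖Literature.Topology.FourManifolds.lamPart y‖ ^ 2 < 1 → 1 - ‖Literature.Topology.FourManifolds.lamPart y‖ ^ 2 ≤ κ ^ 2 / 2 → Summit.SmoothPoincare4.SmoothPoincare4.Theorems.AcyclicBisectionExists.ModpBraidOrbits.PushModel.modelPush κ δ (Literature.Topology.FourManifolds.handleInversion 2 y) = Summit.SmoothPoincare4.SmoothPoincare4.Theorems.AcyclicBisectionExists.ModpBraidOrbits.PushModel.tubePush κ δ y) ∧ (∀ y : EuclideanSpace ℝ (Fin 4), ‖Literature.Topology.FourManifolds.lamPart y‖ = 1 → Literature.Topology.FourManifolds.muPart y = 0 → ‖Literature.Topology.FourManifolds.lamPart (Summit.SmoothPoincare4.SmoothPoincare4.Theorems.AcyclicBisectionExists.ModpBraidOrbits.PushModel.tubePush κ δ y)‖ ^ 2 = Summit.SmoothPoincare4.SmoothPoincare4.Theorems.AcyclicBisectionExists.ModpBraidOrbits.pFun κ 0 ∧ Literature.Topology.FourManifolds.muPart (Summit.SmoothPoincare4.SmoothPoincare4.Theorems.AcyclicBisectionExists.ModpBraidOrbits.PushModel.tubePush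 κ δ y) = 0) := by
  intro κ δ hκ hκ2 hδ
  exact ⟨PushModel.isOpen_tubePushDom hκ, PushModel.circle_subset_tubePushDom hκ, PushModel.contDiffOn_tubePush hκ δ,
    fun y h0 h1 h2 => PushModel.modelPush_handleInversion hκ hκ2 hδ h0 h1 h2,
    fun y h1 h2 => PushModel.tubePush_circle hκ h1 h2⟩

end Summit.SmoothPoincare4.SmoothPoincare4.Theorems.AcyclicBisectionExists.ModpBraidOrbits

end
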